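import Summits.HodgeConjecture.CorCM.Assembly.ModelChain
import Literature.AlgebraicGeometry.HodgeTheory.AbelianVarietyHodgeFullnessOfLieGroupTorus
import Literature.AlgebraicGeometry.ComplexMultiplication.CMAbelianVarietyRealisedOfRiemann
import HarnessLib

/-!
# COR-CM — RESIDUAL FORMS of the stage-2 E term (displayed binders replaced by their landed reductions)

Cell `pub-hodgecm2` (stage 2 of the Hodge ladder), count-neutral companion of `CorCM/Assembly/ModelChain.lean`
(the E term of record `hc_cm_of_PerLFace : HC_CM_of_PerLFace`, p238778).  `HC_CM_of_PerLFace` quantifies over the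
four displayed TOP data `hHD hI h₁ h₃` and takes `PerLFace` of the model universe and stage 1's cited record
`hR : DeligneMilne1982_Thm_6_20_full` (row B02).  This file records, as KERNEL theorems and with no new hypothesis
shapes of its own, what is left of those binders after the reductions that have LANDED in the tree:

* `Model.picardCMUniverse_irrel`, `Model.perLFace_picardCMUniverse_iff` — all four TOP data are PROPOSITIONS, so by
  proof irrelevance the model universe `Model.picardCMUniverse hHD hI h₁ h₃` — hence the hypothesis `PerLFace` — does
  not depend on the chosen proofs: «`PerLFace` of the model» is ONE proposition as soon as the four records hold.
* `hc_cm_of_PerLFace_iff_plugged` — `hHD`, `hI` are tree theorems (`exists_isReal_hodgeModel_holds`,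
  `hodgePQ_independent_of_hodgeModel_holds`): `HC_CM_of_PerLFace` is equivalent to its form over `h₁ h₃ hR` only.
* `hc_cm_of_perLFace_plugged` — the E term with `hHD`, `hI` plugged.
* `hc_cm_of_perLFace_of_lieAddGroup` — RESIDUAL FORM R1: `hR` replaced by the Lie-theoretic statement `hLB`
  («every compact connected commutative complex Lie group modelled on `ℂⁿ` is a complex torus», Lange–Birkenhake
  Lemma 1.1.2 in the weak form of `HodgeTheory.deligneMilne1982_Thm_6_20_full_of_lieAddGroup`, p241479 — the cell's
  row D1-3 is exactly a proof of `hLB`).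
* `hc_cm_of_perLFace_of_lieAddGroup_of_essImage` — RESIDUAL FORM R2: in addition `h₃` replaced by the essential-image
  clause `hE : DeligneMilne1982_Thm_6_20_essImage` of Riemann's theorem, through
  `ComplexMultiplication.cmAbelianVarietyRealised_of_riemann` (p240737).  Remaining displayed hypotheses of stage 2 in
  this form: `hLB` (D1-3), `hE` (D5-5′ β), `h₁ : BallQuotientUniformised` (chain D4) and `PerLFace` itself.
* `hc_cm_of_perL_of_B01_of_lieAddGroup_of_essImage` — the same for the LITERAL target shape (`PerL` + binder B01).

APPEND TARGET (cell convention, lead gen 4 RULING B02-FLIP / CHAIN-MAP ERRATA v2.7): when `hLB`, `hE` (or `h₃` directly)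
and `h₁` become tree theorems, the hypothesis-free display «stage 2 conditional on `PerLFace` only» is appended HERE as a
corollary of R2 (this file is append-only; `CorCM/Interfaces.lean` stays byte-identical, SKELETON-ACK C1).
Nothing is asserted; no definition; axioms ⊆ {propext, Classical.choice, Quot.sound}.
-/

noncomputable section

namespace Summit.HodgeConjecture.CorCM

open scoped Manifold ContDiff
open Literature.NumberTheory.Automorphic.PicardCM
open Literature.AlgebraicGeometry.HodgeTheory
open Literature.AlgebraicGeometry.ComplexMultiplication (cmAbelianVarietyRealised_of_riemann)
open Literature.Geometry.Kaehler (ComplexTorus)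

/-! ## Proof irrelevance: the model universe does not depend on the proofs of the four records -/

/-- The four TOP data `hHD hI h₁ h₃` are propositions, so the Picard–CM model universe built from any two tuples of
proofs is the same universe (definitional proof irrelevance). [folklore] -/
theorem Model.picardCMUniverse_irrel (hHD hHD' : exists_isReal_hodgeModel)
    (hI hI' : hodgePQ_independent_of_hodgeModel) (h₁ h₁' : BallQuotientUniformised)
    (h₃ h₃' : CMAbelianVarietyRealised) :
    Model.picardCMUniverse hHD hI h₁ h₃ = Model.picardCMUniverse hHD' hI' h₁' h₃' :=
  rfl

/-- Hence «`PerLFace` of the model universe» is ONE proposition: it does not depend on the proofs of the records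
it is instantiated at. [folklore] -/
theorem Model.perLFace_picardCMUniverse_iff (hHD hHD' : exists_isReal_hodgeModel)
    (hI hI' : hodgePQ_independent_of_hodgeModel) (h₁ h₁' : BallQuotientUniformised)
    (h₃ h₃' : CMAbelianVarietyRealised) :
    (Model.picardCMUniverse hHD hI h₁ h₃).PerLFace ↔ (Model.picardCMUniverse hHD' hI' h₁' h₃').PerLFace :=
  Iff.rfl

/-! ## `hHD`, `hI` plugged by their tree theorems -/

/-- `HC_CM_of_PerLFace` is equivalent to its form quantified over the two RECORDS `h₁ h₃` only, the Hodge-theoretic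
data `hHD`, `hI` being the tree theorems `exists_isReal_hodgeModel_holds`, `hodgePQ_independent_of_hodgeModel_holds`
(both directions by proof irrelevance). [folklore] -/
theorem hc_cm_of_PerLFace_iff_plugged :
    HC_CM_of_PerLFace ↔
      ∀ (h₁ : BallQuotientUniformised) (h₃ : CMAbelianVarietyRealised),
        (Model.picardCMUniverse exists_isReal_hodgeModel_holds hodgePQ_independent_of_hodgeModel_holds h₁ h₃).PerLFace →
          DeligneMilne1982_Thm_6_20_full → HC_CM :=
  ⟨fun h h₁ h₃ hP hR => h _ _ h₁ h₃ hP hR, fun h _ _ h₁ h₃ hP hR => h h₁ h₃ hP hR⟩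

/-- The E term of record with `hHD`, `hI` plugged: on the model universe over the records `h₁`, `h₃`, the face-form
period theorem and Deligne–Milne 1982 Thm 6.20 (`hR`, row B02) give `HC_CM`. [folklore] -/
theorem hc_cm_of_perLFace_plugged (h₁ : BallQuotientUniformised) (h₃ : CMAbelianVarietyRealised)
    (hR : DeligneMilne1982_Thm_6_20_full)
    (hP : (Model.picardCMUniverse exists_isReal_hodgeModel_holds hodgePQ_independent_of_hodgeModel_holds
      h₁ h₃).PerLFace) :
    HC_CM :=
  hc_cm_of_PerLFace _ _ h₁ h₃ hP hR

/-! ## Residual forms: `hR ⇐ hLB` (p241479) and `h₃ ⇐ hR ∧ hE` (p240737) -/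

section Residual

/- `hLB` — Lange–Birkenhake Lemma 1.1.2, weak form, VERBATIM the hypothesis of
`HodgeTheory.deligneMilne1982_Thm_6_20_full_of_lieAddGroup`: every compact connected Hausdorff commutative complex Lie
group modelled on `ℂⁿ` is, by a holomorphic homeomorphic group isomorphism, a complex torus `ComplexTorus Φ`. -/
variable (hLB : ∀ (n : ℕ) (G : Type) [AddCommGroup G] [TopologicalSpace G] [T2Space G] [CompactSpace G]
      [ConnectedSpace G] [ChartedSpace (Fin n → ℂ) G] [LieAddGroup 𝓘(ℂ, Fin n → ℂ) ω G],
      ∃ (ι : Type) (_ : Fintype ι) (Φ : (ι → ℝ) ≃L[ℝ] (Fin n → ℂ)) (e : ComplexTorus Φ ≃+ G),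
        IsHomeomorph e ∧ MDifferentiable 𝓘(ℂ, Fin n → ℂ) 𝓘(ℂ, Fin n → ℂ) e)

include hLB

/-- **Residual form R1** — the stage-2 E term with row B02 (`hR`) replaced by the Lie-theoretic statement `hLB`
(Lange–Birkenhake Lemma 1.1.2, weak form; the cell's row D1-3), through
`HodgeTheory.deligneMilne1982_Thm_6_20_full_of_lieAddGroup` (p241479: `hR ⇐ hLB` alone, with GAGA for maps and the
lattice-coordinate Hodge computation discharged in the tree). [folklore] -/
theorem hc_cm_of_perLFace_of_lieAddGroup (h₁ : BallQuotientUniformised) (h₃ : CMAbelianVarietyRealised)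
    (hP : (Model.picardCMUniverse exists_isReal_hodgeModel_holds hodgePQ_independent_of_hodgeModel_holds
      h₁ h₃).PerLFace) :
    HC_CM :=
  hc_cm_of_perLFace_plugged h₁ h₃ (deligneMilne1982_Thm_6_20_full_of_lieAddGroup hLB) hP

/-- **Residual form R2** — the stage-2 E term with `hR` replaced by `hLB` (R1) AND the Shimura record
`h₃ : CMAbelianVarietyRealised` replaced by the essential-image clause `hE` of Riemann's theorem, through
`ComplexMultiplication.cmAbelianVarietyRealised_of_riemann` (p240737).  In this form the displayed hypotheses of
stage 2 are exactly: `hLB` (row D1-3), `hE` (row D5-5′ β), `h₁` (chain D4) and the face-form period theorem of the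
model universe. [folklore] -/
theorem hc_cm_of_perLFace_of_lieAddGroup_of_essImage (hE : DeligneMilne1982_Thm_6_20_essImage)
    (h₁ : BallQuotientUniformised)
    (hP : (Model.picardCMUniverse exists_isReal_hodgeModel_holds hodgePQ_independent_of_hodgeModel_holds h₁
      (cmAbelianVarietyRealised_of_riemann (deligneMilne1982_Thm_6_20_full_of_lieAddGroup hLB) hE)).PerLFace) :
    HC_CM :=
  hc_cm_of_perLFace_of_lieAddGroup hLB h₁ _ hP

/-- **Residual form R2, literal target shape** — the same with stage 1's conclusion `PerL` VERBATIM as hypothesis,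
over binder B01 `PerLFace_of_PerL` (gap G-T; model-only by `CorCM/PerLNotPerLFace.lean`). [folklore] -/
theorem hc_cm_of_perL_of_B01_of_lieAddGroup_of_essImage (hB01 : PerLFace_of_PerL)
    (hE : DeligneMilne1982_Thm_6_20_essImage) (h₁ : BallQuotientUniformised)
    (hP : (Model.picardCMUniverse exists_isReal_hodgeModel_holds hodgePQ_independent_of_hodgeModel_holds h₁
      (cmAbelianVarietyRealised_of_riemann (deligneMilne1982_Thm_6_20_full_of_lieAddGroup hLB) hE)).PerL) :
    HC_CM :=
  hc_cm_of_perLFace_of_lieAddGroup_of_essImage hLB hE h₁ (hB01 _ _ _ _ hP)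

end Residual

end Summit.HodgeConjecture.CorCM

end
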